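import Literature.AlgebraicGeometry.HodgeTheory.MonodromySemisimpleSubvariations
import HarnessLib

/-!
# Eigenspaces of a flat, type-preserving endomorphism of `Rᵏ f_* ℂ` are stable sub-variations
# (Deligne 1987, proof of Prop. 1.13: «l'image d'un projecteur `e ∈ End(V) = End(V₀)⁰` … est une
# sous-variation complexe de `V`»)

Family `hodge`, layer `Literature/AlgebraicGeometry/HodgeTheory`; a PROVED corollary file (no named
fact) on the vocabulary of `MonodromySemisimpleSubvariations.lean` (`IsHodgeSubspace`,
`IsTransportStable`, `IsSubvariation`, `transportFun` / `transportLinear`), requested in substance by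
the planner of route `HodgeConjecture/Q8SymplecticPowers` (memo `ROUTE-P3v28-g37.md` §7 (C33) remark
(5): «`IsSubvariation` of `M = ker(τ* − i)` (flat HS-automorphism; S-size)» as one of the bricks an
S4-prover of crux K1Q needs): the carrier of the one-member criteria STAB-TOP / BURNSIDE-TOP is the
eigenspace `M_s = ker(τ* − i) ⊆ H²(X_s(ℂ); ℂ)` of the deck transformation `τ` of the family.

Printed source of the principle: Deligne 1987, proof of Prop. 1.13 (p. 11 of the held text): a
HORIZONTAL endomorphism of degree `0` of a complex variation `V` — one commuting with transport and
preserving the Hodge types in every fibre — has sub-variations as images of its (degree-`0`)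
projectors; the eigenspace for `c` of such a `τ` is the image of the spectral projector `P_c(τ)`, a
polynomial in `τ`, again horizontal of degree `0`. We prove the eigenspace statement directly.

## Contents (all PROVED)

* `isHodgeSubspace_eigenspace` — one fibre: for `X` smooth projective and a `ℂ`-linear endomorphism
  `τ` of `Hᵏ(X(ℂ); ℂ)` preserving every Hodge type `(p, q)`, each eigenspace `ker(τ − c)` is a Hodge
  subspace (uniqueness of the type decomposition of `τ x = c • x`).
* `isTransportStable_eigenspace` — if `τ` commutes with the transports of the loops at `s`, its
  eigenspaces are `H`-stable for every `H ≤ π₁(U, s)`.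
* `map_transportLinear_eigenspace` — for a FLAT family `(τ_t)_{t ∈ U}` (commuting with every
  transport from `s`), transport carries `ker(τ_s − c)` onto `ker(τ_t − c)`.
* `isSubvariation_eigenspace` — for a flat family of type-preserving endomorphisms over a family with
  smooth projective fibres of dimension `n`, `ker(τ_s − c)` is a complex sub-variation.

Instantiation (left to the consumer): `τ_t = (τ|_{X_t})^*` for an automorphism `τ` of `𝒳` over `S`
(flat: transport is natural for maps of families; type-preserving: pull-back by a morphism is a
morphism of Hodge structures), `c = i`.

## References
* [Deligne1987] P. Deligne, Un théorème de finitude pour la monodromie, Progr. Math. 67 (1987) 1–19,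
  §1.11 and proof of Prop. 1.13 (held: book:howe1987-discrete-groups-geometry-analysis, chunks
  p0010–p0011).
* [VoisinHodgeI2002] C. Voisin, Hodge Theory and Complex Algebraic Geometry I, Thm. 6.18, §7.1.1 (type
  decomposition), §9.2.1 (transport).
-/

noncomputable section

open CategoryTheory AlgebraicGeometry
open _root_.Topology
open Literature.AlgebraicTopology.SingularHomology Literature.AlgebraicGeometry.Motives

namespace Literature.AlgebraicGeometry.HodgeTheory

section HodgeTheory

/-! ### One fibre: eigenspaces of a type-preserving endomorphism are Hodge subspaces -/

section OneFibre

variable {n : ℕ} {X : SchemeOver ℂ} {k : ℕ}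

/-- **Eigenspaces of a type-preserving endomorphism are Hodge subspaces.** For `X` smooth projective
and `τ : Hᵏ(X(ℂ); ℂ) → Hᵏ(X(ℂ); ℂ)` `ℂ`-linear with `τ(H^{p,q}) ⊆ H^{p,q}` for all `(p, q)`, every
eigenspace `ker(τ − c)` is a Hodge subspace: if `τ x = c • x` then, comparing the type decompositions
`τ x = ∑ τ(π_{pq} x)` and `c • x = ∑ c • π_{pq} x`, `τ(π_{pq} x) = c • π_{pq} x`.
[cite: Deligne1987, proof of Prop. 1.13 (p. 11)] [cite: VoisinHodgeI2002, Thm. 6.18 and §7.1.1] -/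
theorem isHodgeSubspace_eigenspace (hX : IsSmoothProjective n X)
    (τ : complexBetti X k →ₗ[ℂ] complexBetti X k)
    (hτ : ∀ (p q : ℕ) (x : complexBetti X k), IsOfHodgeType n X k p q x → IsOfHodgeType n X k p q (τ x))
    (c : ℂ) : IsHodgeSubspace n X k (Module.End.eigenspace τ c) := by
  obtain ⟨A⟩ := nonempty_hodgeModel_holds (n := n) (X := X) hX
  rw [isHodgeSubspace_iff_typeProj_mem hX A]
  intro x hx pq
  rw [Module.End.mem_eigenspace_iff] at hx ⊢
  have h1 : ∀ pq', τ (A.typeProj k pq' x) ∈ A.typePiece k pq' := fun pq' ↦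
    A.mem_typePiece_of_isOfHodgeType hodgePQ_independent_of_hodgeModel_holds hX pq'.2
      (hτ _ _ _ (A.isOfHodgeType_of_mem_typePiece (A.typeProj_mem k pq' x)))
  have hsum1 : ∑ pq', τ (A.typeProj k pq' x) = τ x := by rw [← map_sum, A.sum_typeProj]
  have hsum2 : ∑ pq', c • A.typeProj k pq' x = τ x := by rw [← Finset.smul_sum, A.sum_typeProj, hx]
  have e1 := A.typeProj_eq_of_sum_eq h1 hsum1 pq
  have e2 := A.typeProj_eq_of_sum_eq (fun pq' ↦ Submodule.smul_mem _ c (A.typeProj_mem k pq' x))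
    hsum2 pq
  rw [← e1, e2]

end OneFibre

/-! ### In a family: flatness gives stability and transport of eigenspaces -/

section Family

variable {𝒳 S : SchemeOver ℂ} {f : 𝒳 ⟶ S} {k : ℕ} {U : Set (ComplexPoints S)}
  {hU : IsCohomologicallyLocallyTrivialOn f U}

/-- **Eigenspaces of an endomorphism commuting with the monodromy are stable**: if `τ` commutes with
the transports of the loop classes at `s`, then `ker(τ − c)` is `H`-stable for every
`H ≤ π₁(U, s)`. [cite: Deligne1987, §1.12 and proof of Prop. 1.13 (p. 10–11)] -/
theorem isTransportStable_eigenspace {s : U}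
    (τ : complexBetti (fiberOver f s.1) k →ₗ[ℂ] complexBetti (fiberOver f s.1) k)
    (hflat : ∀ (γ : Path.Homotopic.Quotient s s) (x : complexBetti (fiberOver f s.1) k),
      transportFun f k hU γ (τ x) = τ (transportFun f k hU γ x))
    (H : Subgroup (FundamentalGroup U s)) (c : ℂ) :
    IsTransportStable f k hU s H (Module.End.eigenspace τ c) := by
  intro γ _ x hx
  rw [Module.End.mem_eigenspace_iff] at hx
  rw [Module.End.mem_eigenspace_iff, loopTransport_apply, ← hflat, hx, transportFun_smul]

/-- **Transport carries eigenspaces of a flat family onto eigenspaces**: for a family `(τ_t)_{t ∈ U}`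
of endomorphisms commuting with every transport from `s`, `γ_* ker(τ_s − c) = ker(τ_t − c)`.
[cite: Deligne1987, §1.11 and proof of Prop. 1.13 (p. 10–11)] -/
theorem map_transportLinear_eigenspace {s : U}
    (τ : ∀ t : U, complexBetti (fiberOver f t.1) k →ₗ[ℂ] complexBetti (fiberOver f t.1) k)
    (hflat : ∀ (t : U) (γ : Path.Homotopic.Quotient s t) (x : complexBetti (fiberOver f s.1) k),
      transportFun f k hU γ (τ s x) = τ t (transportFun f k hU γ x))
    (c : ℂ) (t : U) (γ : Path.Homotopic.Quotient s t) :
    (Module.End.eigenspace (τ s) c).map (transportLinear f k hU γ) = Module.End.eigenspace (τ t) c := by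
  apply le_antisymm
  · rintro _ ⟨x, hx, rfl⟩
    replace hx : τ s x = c • x := Module.End.mem_eigenspace_iff.1 hx
    rw [Module.End.mem_eigenspace_iff, transportLinear_apply, ← hflat, hx, transportFun_smul]
  · intro y hy
    rw [Module.End.mem_eigenspace_iff] at hy
    refine ⟨transportFun f k hU γ.symm y, Module.End.mem_eigenspace_iff.2 ?_,
      transportFun_transportFun_symm f k hU γ y⟩
    have hinj : Function.Injective (transportFun f k hU γ) :=
      Function.LeftInverse.injective fun a ↦ transportFun_symm_transportFun f k hU γ a
    apply hinj
    rw [hflat, transportFun_transportFun_symm, transportFun_smul, transportFun_transportFun_symm, hy]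

/-- **Eigenspaces of a flat, type-preserving family of endomorphisms are complex sub-variations**
(all fibres smooth projective of dimension `n`): transport carries `ker(τ_s − c)` onto `ker(τ_t − c)`,
a Hodge subspace of `Hᵏ(X_t(ℂ); ℂ)`. With `isTransportStable_eigenspace`: an `H`-stable sub-variation
for every `H ≤ π₁(U, s)` — e.g. `M = ker(τ* − i)` for the deck transformation `τ` of a family.
[cite: Deligne1987, §1.11 and proof of Prop. 1.13 (p. 10–11)] -/
theorem isSubvariation_eigenspace {n : ℕ} (hf : ∀ t : U, IsSmoothProjective n (fiberOver f t.1))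
    {s : U} (τ : ∀ t : U, complexBetti (fiberOver f t.1) k →ₗ[ℂ] complexBetti (fiberOver f t.1) k)
    (hflat : ∀ (t : U) (γ : Path.Homotopic.Quotient s t) (x : complexBetti (fiberOver f s.1) k),
      transportFun f k hU γ (τ s x) = τ t (transportFun f k hU γ x))
    (htype : ∀ (t : U) (p q : ℕ) (x : complexBetti (fiberOver f t.1) k),
      IsOfHodgeType n (fiberOver f t.1) k p q x → IsOfHodgeType n (fiberOver f t.1) k p q (τ t x))
    (c : ℂ) : IsSubvariation f k hU n s (Module.End.eigenspace (τ s) c) := by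
  intro t γ
  rw [map_transportLinear_eigenspace τ hflat c t γ]
  exact isHodgeSubspace_eigenspace (hf t) (τ t) (htype t) c

end Family

end HodgeTheory

end Literature.AlgebraicGeometry.HodgeTheory

end
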